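import Mathlib
import Literature.Barriers.ValiantsHypothesis.AlgebraicNaturalProofs
import Summits.ValiantsHypothesis.ValiantsHypothesis.Theorems.BarrierLeverPartitionMinorsHitByVPSimplexJoinCoefficients

/-!
# Route BarrierLever — item `PartitionMinorsHitByVP` (stmt-ValiantsHypothesis-19717):
# the SIMPLEX-PRODUCT JOIN DOOR, part 2/2 — exact supports: no weights, no threshold legality

Helper file (`--supports stmt-ValiantsHypothesis-19717`; cell valiant-natproofs, rung V4, 𝒟-side door (c),
line `hidden_states`; prover seat val-np-p3 gen 11). Definition-free. Closes NO item; part 1 (`…SimplexJoinCoefficients`) has the coefficient formula and the size bound; the typed nodes and the by-name arrows to the item are in `…SimplexJoinNodes`.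

THE WITNESS. For `m` pieces, depth `D`, width `N`, live-vertex sets `S p f ⊆ Fin N` and tables
`tab p : Option (Fin D × Fin N) → σ → ℂ` (row `none` = the base point of piece `p`) put, with `E(t) = ∏_v (1 + t_v X_v)`,

  `F = Σ_p E(tab p none) · ∏_{f < D} (1 + Σ_{j ∈ S p f} E(tab p (f, j)))`.

Expanding the product over the factors `f` and taking a SQUARE-FREE coefficient (`coeff_simplexPiece`,
`coeff_partition_simplexJoin`) gives, on a partition layout `(u, w)`,

  `N[U, W] = Σ_{(p, g)} [g live] · α_{p,g}^U · β_{p,g}^W`,  `α_{p,g} = tx p none + Σ_f tx p (f, g f)`,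

the sum running over ALL `g : Fin D → Option (Fin N)` («vertex `g f` of the `f`-th simplex, or none») with the
indicator `[g live] = ∏_f [g f = none ∨ g f ∈ S p f]`. The live columns are EXACTLY the product of simplices
`∏_f ({none} ∪ S p f)`: a MINKOWSKI SUM of `D` simplices per piece. Hence, if a layout of size `r` is enumerated
by an injective `e : Fin r → Fin m × (Fin D → Option (Fin N))` whose range is precisely the live set, the layout
matrix is `A · Bᵀ` with BOTH factors SQUARE — `det = det A · det B` (`partitionMinor_hit_of_simplexJoin`); no
Cauchy–Binet leading term, no weights, no threshold («legality») condition. With `m ≤ (2h)²`, `D, N ≤ 2h`,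
`h ≥ 3` the truncated witness lies in `SmallCircuits ℂ (h+h) 9` (`partitionMinor_hit_of_simplexJoin_mem`).

WHY (val-np-p3 g11): the registered join doors (`…HiddenStatesJoin`, `…StubJoinDoorWide`) generate each piece
by the FULL cube product `∏_q (1 + λ_q E_q)`, so every subset of states is a column and the design must be cut out
as the UNIQUE lightest `r`-set — a threshold family. Generating a piece by `∏_f (1 + Σ_{j∈S_f} E_{f,j})` instead
produces exactly `∏_f (|S_f|+1)` columns: designs may be products of simplices of any sizes (Minkowski sums of stars —
neither down-sets of one cube nor threshold families), e.g. the base-`n` DIGIT JOIN (`r = Σ c_i n^i`, `c_i` copies of the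
`i`-fold Minkowski power of an `n`-simplex). CENSUS (kit j300341, evidence on 19717; `n ∈ {h−1, h+1, 2h}`, the joinlib zoo
+ random/shifted lower families, all `r`): `h ≤ 8` — 0 bad of ≈ 3 400; `h = 9, 10` — 2 bad of ≈ 3 750, both the SINGLE
`10 × 10` grid (`h = 9`, `r = 100`, `n = 10`) against the 46 sets of size `≤ 2` plus 54 triples inside 8 coordinates
(`corank 1`). MECHANISM (necessary condition, seat memo): if two factors of a piece have `≥ a + 2` vertices each, the
tensor `λ ⊗ μ` of their affine dependencies on `a` coordinates annihilates every monomial of degree `≤ 3` supported there,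
so the piece's columns are dependent against EVERY such family — factor sizes of a universal design must decay
(`n_(2) ≲ r^{1/3}`, `n_(3) ≲ r^{1/5}`, …). The typed nodes (`…SimplexJoinNodes`) therefore quantify over designs, not over one formula.

WHAT THIS IS NOT: no design is proved universal here; item 19717 stays OPEN; nothing on crux 14610 or VP ≠ VNP.
-/

set_option linter.dupNamespace false

namespace Summit.ValiantsHypothesis.ValiantsHypothesis.Theorems.BarrierLever.SimplexJoin

open Finset MvPolynomial Matrix
open Literature.Barriers.ValiantsHypothesis Literature.Computability.AlgebraicComplexity
open Summit.ValiantsHypothesis.ValiantsHypothesis.Theorems.BarrierLever.AdditiveDoor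
  (truncation_spec degree_partitionExpo_le)

noncomputable section

variable {h : ℕ}

/-! ## 4. The door -/

/-- **THE SIMPLEX-PRODUCT JOIN DOOR (explicit size).** Let `(u, w)` be a layout of size `r` and let
`e : Fin r → Fin m × (Fin D → Option (Fin N))` enumerate injectively EXACTLY the live columns of the design
(`(p, g)` is live iff every chosen vertex `g f = some j` has `j ∈ S p f`). If for some tables `tx, ty` (one base row
`none` and one row per `(f, j)` for each piece) BOTH square matrices
`[∏_{a ∈ u i} (tx p none a + Σ_f (g f).elim 0 (tx p (f,·) a))]_{i, (p,g) = e k}` and the `y`-analogue are nonsingular,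
then some `f` of degree `≤ 2h` and size `≤ (2h+2)²·(m(6h + D(6hN + N + 1) + D + 1) + m) + 2h + 1` has a nonsingular
partition matrix on `(u, w)`. No weights and no threshold condition: the two factors are square. -/
theorem partitionMinor_hit_of_simplexJoin (h m D N r : ℕ) (u w : Fin r → Finset (Fin h))
    (S : Fin m → Fin D → Finset (Fin N))
    (e : Fin r → Fin m × (Fin D → Option (Fin N))) (he : Function.Injective e)
    (hlive : ∀ c : Fin m × (Fin D → Option (Fin N)),
      c ∈ Set.range e ↔ ∀ (f : Fin D) (j : Fin N), c.2 f = some j → j ∈ S c.1 f)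
    (tx ty : Fin m → Option (Fin D × Fin N) → Fin h → ℂ)
    (hx : (Matrix.of fun i k : Fin r => ∏ a ∈ u i,
      (tx (e k).1 none a + ∑ f : Fin D, ((e k).2 f).elim 0 fun j => tx (e k).1 (some (f, j)) a)).det ≠ 0)
    (hy : (Matrix.of fun i k : Fin r => ∏ c ∈ w i,
      (ty (e k).1 none c + ∑ f : Fin D, ((e k).2 f).elim 0 fun j => ty (e k).1 (some (f, j)) c)).det ≠ 0) :
    ∃ F : MvPolynomial (Fin (h + h)) ℂ, F.totalDegree ≤ h + h ∧
      complexity F ≤ (h + h + 2) ^ 2 * (m * (3 * (h + h) + (D * (N * (3 * (h + h)) + N + 1) + D) + 1) + m) +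
        (h + h + 1) ∧
      (Matrix.of fun i j : Fin r => MvPolynomial.coeff
        (∑ a ∈ u i, Finsupp.single (Fin.castAdd h a) 1 +
          ∑ c ∈ w j, Finsupp.single (Fin.natAdd h c) 1) F).det ≠ 0 := by
  classical
  -- combined table on `Fin (h + h)`
  set tab : Fin m → Option (Fin D × Fin N) → Fin (h + h) → ℂ :=
    fun p o v => Fin.addCases (tx p o) (ty p o) v with htab
  set F : MvPolynomial (Fin (h + h)) ℂ := ∑ p : Fin m, ((∏ v : Fin (h + h), (1 + C (tab p none v) * X v)) *
      ∏ f : Fin D, (1 + ∑ j ∈ S p f, ∏ v : Fin (h + h), (1 + C (tab p (some (f, j)) v) * X v))) with hF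
  obtain ⟨hdeg, hcoeff, hsize⟩ := truncation_spec F (h + h)
  refine ⟨∑ d ∈ Finset.range (h + h + 1), homogeneousComponent d F, hdeg, ?_, ?_⟩
  · exact hsize.trans (by have := complexity_simplexJoin_le tab S; rw [← hF] at this; gcongr)
  · -- the square factors on the enumerated (live) columns and the liveness weight on ALL columns
    set Ae : Matrix (Fin r) (Fin r) ℂ := Matrix.of fun i k : Fin r => ∏ a ∈ u i,
      (tx (e k).1 none a + ∑ f : Fin D, ((e k).2 f).elim 0 fun j => tx (e k).1 (some (f, j)) a) with hAe
    set Be : Matrix (Fin r) (Fin r) ℂ := Matrix.of fun i k : Fin r => ∏ c ∈ w i,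
      (ty (e k).1 none c + ∑ f : Fin D, ((e k).2 f).elim 0 fun j => ty (e k).1 (some (f, j)) c) with hBe
    set A : Matrix (Fin r) (Fin m × (Fin D → Option (Fin N))) ℂ := Matrix.of fun i c => ∏ a ∈ u i,
      (tx c.1 none a + ∑ f : Fin D, (c.2 f).elim 0 fun j => tx c.1 (some (f, j)) a) with hA
    set B : Matrix (Fin r) (Fin m × (Fin D → Option (Fin N))) ℂ := Matrix.of fun i c => ∏ a ∈ w i,
      (ty c.1 none a + ∑ f : Fin D, (c.2 f).elim 0 fun j => ty c.1 (some (f, j)) a) with hB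
    set wl : Fin m × (Fin D → Option (Fin N)) → ℂ :=
      fun c => ∏ f : Fin D, (c.2 f).elim 1 fun j => if j ∈ S c.1 f then (1 : ℂ) else 0 with hwl
    have hwl_live : ∀ c : Fin m × (Fin D → Option (Fin N)), c ∈ Set.range e → wl c = 1 := by
      intro c hc
      rw [hlive] at hc
      rw [hwl]
      refine Finset.prod_eq_one fun f _ => ?_
      rcases hgf : c.2 f with _ | j
      · simp [Option.elim]
      · simp [Option.elim, hc f j hgf]
    have hwl_dead : ∀ c : Fin m × (Fin D → Option (Fin N)), c ∉ Set.range e → wl c = 0 := by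
      intro c hc
      rw [hlive] at hc
      push Not at hc
      obtain ⟨f, j, hgf, hj⟩ := hc
      rw [hwl]
      exact Finset.prod_eq_zero (Finset.mem_univ f) (by rw [hgf]; simp [Option.elim, hj])
    have hterm : ∀ (i j : Fin r) (c : Fin m × (Fin D → Option (Fin N))),
        (∏ f : Fin D, (c.2 f).elim 1 fun j => if j ∈ S c.1 f then (1 : ℂ) else 0) *
          ((∏ a ∈ u i, (tab c.1 none (Fin.castAdd h a) +
              ∑ f : Fin D, (c.2 f).elim 0 fun j => tab c.1 (some (f, j)) (Fin.castAdd h a))) *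
            ∏ c' ∈ w j, (tab c.1 none (Fin.natAdd h c') +
              ∑ f : Fin D, (c.2 f).elim 0 fun j => tab c.1 (some (f, j)) (Fin.natAdd h c'))) =
          wl c * (A i c * B j c) := by
      intro i j c
      have hxs : ∀ (o : Option (Fin D × Fin N)) (a : Fin h), tab c.1 o (Fin.castAdd h a) = tx c.1 o a := by
        intro o a; simp only [htab]; exact Fin.addCases_left _
      have hys : ∀ (o : Option (Fin D × Fin N)) (a : Fin h), tab c.1 o (Fin.natAdd h a) = ty c.1 o a := by
        intro o a; simp only [htab]; exact Fin.addCases_right _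
      simp only [hwl, hA, hB, Matrix.of_apply, hxs, hys]
    have hmat : (Matrix.of fun i j : Fin r => MvPolynomial.coeff
        (∑ a ∈ u i, Finsupp.single (Fin.castAdd h a) 1 +
          ∑ c ∈ w j, Finsupp.single (Fin.natAdd h c) 1)
        (∑ d ∈ Finset.range (h + h + 1), homogeneousComponent d F)) = Ae * Beᵀ := by
      refine Matrix.ext fun i j => ?_
      rw [Matrix.of_apply, hcoeff _ (degree_partitionExpo_le _ _), hF, coeff_partition_simplexJoin,
        Matrix.mul_apply]
      -- the double sum over (piece, vertex choice) as one sum over all columns, weighted by liveness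
      have hL : (∑ p : Fin m, ∑ g : Fin D → Option (Fin N),
          (∏ f : Fin D, (g f).elim 1 fun j => if j ∈ S p f then (1 : ℂ) else 0) *
          ((∏ a ∈ u i, (tab p none (Fin.castAdd h a) +
              ∑ f : Fin D, (g f).elim 0 fun j => tab p (some (f, j)) (Fin.castAdd h a))) *
            ∏ c ∈ w j, (tab p none (Fin.natAdd h c) +
              ∑ f : Fin D, (g f).elim 0 fun j => tab p (some (f, j)) (Fin.natAdd h c)))) =
          ∑ c : Fin m × (Fin D → Option (Fin N)), wl c * (A i c * B j c) := by
        rw [Fintype.sum_prod_type]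
        exact Finset.sum_congr rfl fun p _ => Finset.sum_congr rfl fun g _ => hterm i j (p, g)
      rw [hL]
      -- only the live columns (= `range e`) survive
      rw [← Finset.sum_filter_add_sum_filter_not Finset.univ
        (fun c : Fin m × (Fin D → Option (Fin N)) => c ∈ Set.range e)]
      have hzero : ∑ c ∈ Finset.univ.filter (fun c : Fin m × (Fin D → Option (Fin N)) => ¬ c ∈ Set.range e),
          wl c * (A i c * B j c) = 0 := by
        refine Finset.sum_eq_zero fun c hc => ?_
        rw [Finset.mem_filter] at hc
        rw [hwl_dead c hc.2, zero_mul]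
      rw [hzero, add_zero]
      have himage : Finset.univ.filter (fun c : Fin m × (Fin D → Option (Fin N)) => c ∈ Set.range e) =
          Finset.univ.image e := by
        ext c
        simp only [Finset.mem_filter, Finset.mem_univ, true_and, Set.mem_range, Finset.mem_image]
      rw [himage, Finset.sum_image (fun k _ k' _ hkk => he hkk)]
      refine Finset.sum_congr rfl fun k _ => ?_
      rw [hwl_live (e k) ⟨k, rfl⟩, one_mul, Matrix.transpose_apply, hAe, hBe, hA, hB]
      simp only [Matrix.of_apply]
    rw [hmat, Matrix.det_mul, Matrix.det_transpose]
    exact mul_ne_zero hx hy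

/-- **THE SIMPLEX-PRODUCT JOIN DOOR (class form).** With `m ≤ (2h)²` pieces, depth `D ≤ 2h`, width `N ≤ 2h` and
`h ≥ 3` the witness lies in `SmallCircuits ℂ (h+h) 9`. -/
theorem partitionMinor_hit_of_simplexJoin_mem (h m D N r : ℕ) (hh : 3 ≤ h) (hm : m ≤ (h + h) ^ 2)
    (hD : D ≤ h + h) (hN : N ≤ h + h) (u w : Fin r → Finset (Fin h))
    (S : Fin m → Fin D → Finset (Fin N))
    (e : Fin r → Fin m × (Fin D → Option (Fin N))) (he : Function.Injective e)
    (hlive : ∀ c : Fin m × (Fin D → Option (Fin N)),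
      c ∈ Set.range e ↔ ∀ (f : Fin D) (j : Fin N), c.2 f = some j → j ∈ S c.1 f)
    (tx ty : Fin m → Option (Fin D × Fin N) → Fin h → ℂ)
    (hx : (Matrix.of fun i k : Fin r => ∏ a ∈ u i,
      (tx (e k).1 none a + ∑ f : Fin D, ((e k).2 f).elim 0 fun j => tx (e k).1 (some (f, j)) a)).det ≠ 0)
    (hy : (Matrix.of fun i k : Fin r => ∏ c ∈ w i,
      (ty (e k).1 none c + ∑ f : Fin D, ((e k).2 f).elim 0 fun j => ty (e k).1 (some (f, j)) c)).det ≠ 0) :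
    ∃ F ∈ SmallCircuits ℂ (h + h) 9,
      (Matrix.of fun i j : Fin r => MvPolynomial.coeff
        (∑ a ∈ u i, Finsupp.single (Fin.castAdd h a) 1 +
          ∑ c ∈ w j, Finsupp.single (Fin.natAdd h c) 1) F).det ≠ 0 := by
  obtain ⟨F, hdeg, hsize, hF⟩ := partitionMinor_hit_of_simplexJoin h m D N r u w S e he hlive tx ty hx hy
  refine ⟨F, ⟨hdeg, hsize.trans ?_⟩, hF⟩
  -- crude arithmetic: with H = 2h ≥ 6 every factor is a small polynomial in H
  set H := h + h with hH
  have hH6 : 6 ≤ H := by omega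
  have hHpos : 0 < H := by omega
  have hP : 3 * H + (D * (N * (3 * H) + N + 1) + D) + 1 ≤ 4 * H ^ 3 := by
    calc 3 * H + (D * (N * (3 * H) + N + 1) + D) + 1
        ≤ 3 * H + (H * (H * (3 * H) + H + 1) + H) + 1 := by gcongr
      _ = 3 * H ^ 3 + H ^ 2 + 5 * H + 1 := by ring
      _ ≤ 3 * H ^ 3 + H ^ 3 := by nlinarith [pow_le_pow_left₀ (Nat.zero_le 6) hH6 2]
      _ = 4 * H ^ 3 := by ring
  have hsq : (H + 2) ^ 2 ≤ 2 * H ^ 2 := by nlinarith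
  have h47 : H ^ 4 ≤ H ^ 7 := Nat.pow_le_pow_right hHpos (by norm_num)
  have h17 : H ≤ H ^ 7 := by
    calc H = H ^ 1 := (pow_one H).symm
      _ ≤ H ^ 7 := Nat.pow_le_pow_right hHpos (by norm_num)
  have h07 : 1 ≤ H ^ 7 := Nat.one_le_pow _ _ hHpos
  have h12 : 12 ≤ H ^ 2 := by nlinarith
  calc (H + 2) ^ 2 * (m * (3 * H + (D * (N * (3 * H) + N + 1) + D) + 1) + m) + (H + 1)
      ≤ (2 * H ^ 2) * (H ^ 2 * (4 * H ^ 3) + H ^ 2) + (H + 1) := by gcongr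
    _ = 8 * H ^ 7 + 2 * H ^ 4 + H + 1 := by ring
    _ ≤ 8 * H ^ 7 + 2 * H ^ 7 + H ^ 7 + H ^ 7 := by gcongr
    _ = 12 * H ^ 7 := by ring
    _ ≤ H ^ 2 * H ^ 7 := Nat.mul_le_mul_right _ h12
    _ = H ^ 9 := by ring

end

end Summit.ValiantsHypothesis.ValiantsHypothesis.Theorems.BarrierLever.SimplexJoin
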